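import Literature.MathematicalPhysics.QuantumFieldTheory.Balaban1983to89.AveragingRT
import HarnessLib

/-!
# R3 (cell `ym3-torus`, YM₃ on T³ — a ladder RUNG, NOT d = 4, NOT infinite volume, NOT a mass gap, NOT the Clay problem) —
# **READ-SET FACTORISATION UNDER PRODUCT HAAR: a density reading only the bonds of `S` and a map reading only the bonds off `S` are independent —
# `((dU).withDensity f).map φ = (∫⁻ f dU) • (dU.map φ)`, with the Tonelli, Bochner and event forms**

Width seat `ym3-torus-px8` g12 on crux `stmt-QuantumFields-19936` `UnitScaleTilt.HistoryTailL` (`--supports`, helper = SUPPLY side per ★★OWNER WORDS 83∕84; THEOREMS ONLY, 0 `def`, 0 `sorry`).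
The N08 seat's (128) «read-set Fubini factorisation» (`pub-ymgap-dag-n08-d` g47 s2 03:13Z hand-over; my «MINE» 03:14Z) — the input of the DELETION step of the (β4) cluster expansion (a finished
cluster's shape, reading `S`, against the live clusters' variables, reading `Sᶜ`).  RECORD CURRENCY: currency-agnostic kinematics of product Haar `AveragingRT.fieldMeasure` (lit letters); no
record row touched.

THE ARGUMENT (doubling; no `piEquivPiSubtypeProd`, no `iIndepFun` API).  On `dU ⊗ dU` the coordinate MIX `Ψ(U, U′) := (U on S, U′ off S)` pushes `dU ⊗ dU` to `dU` (product Haar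
is determined by boxes, `Measure.pi_eq` + `Measure.pi_pi`; the box under `Ψ` is a product of two boxes with `univ` factors); a density reading `S` satisfies `f∘Ψ = f∘fst`, a map reading `Sᶜ`
satisfies `φ∘Ψ = φ∘snd`; so `∫ f·(h∘φ) dU = ∫ (f∘fst)·(h∘φ∘snd) d(dU⊗dU) = (∫f)·(∫h∘φ)` (`lintegral_prod_mul`).

CONTENTS.  §1 `measurable_mix`, `mix_preimage_pi` (the box identity), `fieldMeasure_univ_pi`, ★ `map_mix_prod_eq` (`(dU ⊗ dU)∘Ψ⁻¹ = dU`); §2 ★★★ `lintegral_mul_eq_mul_of_readSets` (`∫⁻ f·h = (∫⁻ f)(∫⁻ h)` for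
`f` reading `S`, `h` reading `Sᶜ`), ★★★ `map_withDensity_eq_smul_map_of_readSets` (the measure form above), ★ `map_restrict_eq_smul_map_of_readSets` (event form), ★ `integral_mul_eq_mul_of_readSets`
(Bochner form for real `f`, `h`, via `integral_prod_mul`).

HONEST SCOPE.  [folklore] measure theory (independence of disjoint coordinate blocks of a finite product measure), typed on the tree's `GaugeField`∕`fieldMeasure`; nothing of hTop ∕ (β4) ∕
any (α)-record row ∕ `HistoryTailL` (19936) ∕ the rung ∕ d = 4 ∕ a mass gap ∕ Clay is proved here.  YM₃ on T³ is rung R3 of the ladder, not the Clay problem.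

References: T. Bałaban, Commun. Math. Phys. **98** (1985) 17–51 [Balaban1985Averaging] ((10) p. 19: the product Haar measure `dU`); T. Bałaban, Commun. Math. Phys. **109** (1987)
249–301 [Balaban1987RG1] ((0.4) p. 253).
-/

set_option autoImplicit false

noncomputable section

open MeasureTheory
open scoped ENNReal

namespace Summit.QuantumFields.YangMills.Theorems.UV3ReadSetFactorisation

open Literature.MathematicalPhysics.QuantumFieldTheory.Balaban1983to89
open Literature.MathematicalPhysics.QuantumFieldTheory.Balaban1983to89.AveragingRT

variable {P : Params} {j : ℕ} {G : Type*} [GaugeGroup G] [MeasurableSpace G] [HaarData G]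

/-! ## §1 The coordinate mix of two independent copies -/
section Mix

variable (S : Set (PBond P j)) [DecidablePred (· ∈ S)]

omit [GaugeGroup G] [HaarData G] in
/-- The coordinate mix `Ψ(U, U′) = (U on S, U′ off S)` is measurable. [folklore] -/
theorem measurable_mix : Measurable fun p : GaugeField P j G × GaugeField P j G =>
    (fun b : PBond P j => if b ∈ S then p.1 b else p.2 b : GaugeField P j G) := by
  refine measurable_pi_iff.mpr fun b => ?_
  by_cases hb : b ∈ S
  · simp only [hb, if_true]; exact (measurable_pi_apply b).comp measurable_fst
  · simp only [hb, if_false]; exact (measurable_pi_apply b).comp measurable_snd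

omit [GaugeGroup G] [MeasurableSpace G] [HaarData G] in
/-- The preimage of a box under the mix is a product of two boxes with `univ` factors. [folklore] -/
theorem mix_preimage_pi (s : PBond P j → Set G) :
    (fun p : GaugeField P j G × GaugeField P j G => (fun b : PBond P j => if b ∈ S then p.1 b else p.2 b : GaugeField P j G)) ⁻¹'
        (Set.univ.pi s) =
      ((Set.univ.pi fun b => if b ∈ S then s b else Set.univ : Set (GaugeField P j G)) ×ˢ
        (Set.univ.pi fun b => if b ∈ S then Set.univ else s b : Set (GaugeField P j G))) := by
  ext p
  simp only [Set.mem_preimage, Set.mem_univ_pi]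
  constructor
  · intro h
    refine ⟨fun b => ?_, fun b => ?_⟩
    · by_cases hb : b ∈ S
      · simpa [hb] using h b
      · simp [hb]
    · by_cases hb : b ∈ S
      · simp [hb]
      · simpa [hb] using h b
  · rintro ⟨h1, h2⟩ b
    by_cases hb : b ∈ S
    · simpa [hb] using h1 b
    · simpa [hb] using h2 b

/-- Product Haar on boxes: `dU(Π_b s_b) = Π_b haar(s_b)` (`Measure.pi_pi`, read through the `fieldMeasure` wrapper). [cite: Balaban1985Averaging, (10) p.19] -/
theorem fieldMeasure_univ_pi (s : PBond P j → Set G) :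
    fieldMeasure P j G (Set.univ.pi s : Set (GaugeField P j G)) = ∏ b, (HaarData.haar : Measure G) (s b) := by
  show Measure.pi (fun _ : PBond P j => (HaarData.haar : Measure G)) (Set.univ.pi s) = _
  exact Measure.pi_pi _ s

/-- ★ **THE MIX OF TWO INDEPENDENT HAAR COPIES IS HAAR**: `(dU ⊗ dU)∘Ψ⁻¹ = dU` (boxes: `Measure.pi_eq`, `Measure.pi_pi`, `Measure.prod_prod`; each coordinate contributes `haar(s_b)·haar(univ)`).
[cite: Balaban1985Averaging, (10) p.19] -/
theorem map_mix_prod_eq :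
    ((fieldMeasure P j G).prod (fieldMeasure P j G)).map
        (fun p : GaugeField P j G × GaugeField P j G => (fun b : PBond P j => if b ∈ S then p.1 b else p.2 b : GaugeField P j G)) =
      fieldMeasure P j G := by
  haveI : IsProbabilityMeasure (HaarData.haar : Measure G) := HaarData.isProb
  have key : ∀ s : PBond P j → Set G, (∀ b, MeasurableSet (s b)) →
      ((fieldMeasure P j G).prod (fieldMeasure P j G)).map
          (fun p : GaugeField P j G × GaugeField P j G => (fun b : PBond P j => if b ∈ S then p.1 b else p.2 b : GaugeField P j G))
          (Set.univ.pi s) = ∏ b, (HaarData.haar : Measure G) (s b) := by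
    intro s hs
    rw [Measure.map_apply (measurable_mix (G := G) S) (MeasurableSet.univ_pi hs), mix_preimage_pi (G := G) S s]
    have hprod := Measure.prod_prod (μ := fieldMeasure P j G) (ν := fieldMeasure P j G)
      (Set.univ.pi fun b => if b ∈ S then s b else Set.univ : Set (GaugeField P j G))
      (Set.univ.pi fun b => if b ∈ S then Set.univ else s b : Set (GaugeField P j G))
    refine hprod.trans ?_
    rw [fieldMeasure_univ_pi, fieldMeasure_univ_pi, ← Finset.prod_mul_distrib]
    refine Finset.prod_congr rfl fun b _ => ?_
    by_cases hb : b ∈ S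
    · simp [hb]
    · simp [hb]
  exact (Measure.pi_eq key).symm

end Mix

/-! ## §2 Independence of a density reading `S` from a map reading `Sᶜ` -/
section Factorisation

variable (S : Set (PBond P j))

/-- ★★★ **TONELLI FORM**: `f` measurable reading only the bonds of `S` and `h` measurable reading only the bonds off `S` ⇒ `∫⁻ f·h dU = (∫⁻ f dU)·(∫⁻ h dU)`.
[cite: Balaban1985Averaging, (10) p.19] -/
theorem lintegral_mul_eq_mul_of_readSets {f h : GaugeField P j G → ℝ≥0∞} (hf : Measurable f) (hh : Measurable h)
    (hfS : ∀ U U' : GaugeField P j G, (∀ b ∈ S, U b = U' b) → f U = f U')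
    (hhS : ∀ U U' : GaugeField P j G, (∀ b ∉ S, U b = U' b) → h U = h U') :
    ∫⁻ U, f U * h U ∂(fieldMeasure P j G) = (∫⁻ U, f U ∂(fieldMeasure P j G)) * ∫⁻ U, h U ∂(fieldMeasure P j G) := by
  classical
  have hmp : MeasurePreserving
      (fun p : GaugeField P j G × GaugeField P j G => (fun b : PBond P j => if b ∈ S then p.1 b else p.2 b : GaugeField P j G))
      ((fieldMeasure P j G).prod (fieldMeasure P j G)) (fieldMeasure P j G) :=
    ⟨measurable_mix (G := G) S, map_mix_prod_eq (G := G) S⟩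
  have hfh : Measurable fun U : GaugeField P j G => f U * h U := hf.mul hh
  -- the mix agrees with the first copy on `S` and with the second off `S`
  have h2 : ∀ p : GaugeField P j G × GaugeField P j G,
      f (fun b : PBond P j => if b ∈ S then p.1 b else p.2 b) * h (fun b : PBond P j => if b ∈ S then p.1 b else p.2 b) =
        f p.1 * h p.2 := by
    intro p
    have hfp : f (fun b : PBond P j => if b ∈ S then p.1 b else p.2 b) = f p.1 :=
      hfS _ p.1 (fun b hb => by simp [hb])
    have hhp : h (fun b : PBond P j => if b ∈ S then p.1 b else p.2 b) = h p.2 :=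
      hhS _ p.2 (fun b hb => by simp [hb])
    rw [hfp, hhp]
  refine (hmp.lintegral_comp hfh).symm.trans ((lintegral_congr fun p => h2 p).trans ?_)
  exact lintegral_prod_mul hf.aemeasurable hh.aemeasurable

/-- ★★★ **MEASURE FORM**: `f ≥ 0` measurable reading only `S`, `φ` measurable reading only `Sᶜ` ⇒ `((dU).withDensity f).map φ = (∫⁻ f dU) • (dU.map φ)` — under `f·dU` the data off `S` keep their
Haar-induced law, scaled by `∫f`. [cite: Balaban1985Averaging, (10) p.19] -/
theorem map_withDensity_eq_smul_map_of_readSets {Y : Type*} [MeasurableSpace Y] {f : GaugeField P j G → ℝ≥0∞} (hf : Measurable f)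
    (hfS : ∀ U U' : GaugeField P j G, (∀ b ∈ S, U b = U' b) → f U = f U')
    {φ : GaugeField P j G → Y} (hφ : Measurable φ)
    (hφS : ∀ U U' : GaugeField P j G, (∀ b ∉ S, U b = U' b) → φ U = φ U') :
    ((fieldMeasure P j G).withDensity f).map φ = (∫⁻ U, f U ∂(fieldMeasure P j G)) • (fieldMeasure P j G).map φ := by
  ext A hA
  rw [Measure.map_apply hφ hA, withDensity_apply _ (hφ hA), Measure.smul_apply, smul_eq_mul, Measure.map_apply hφ hA]
  have hind : Measurable fun U : GaugeField P j G => (φ ⁻¹' A).indicator (fun _ => (1 : ℝ≥0∞)) U :=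
    measurable_const.indicator (hφ hA)
  have h0 : ∫⁻ U in φ ⁻¹' A, f U ∂(fieldMeasure P j G) =
      ∫⁻ U, f U * (φ ⁻¹' A).indicator (fun _ => (1 : ℝ≥0∞)) U ∂(fieldMeasure P j G) := by
    rw [← lintegral_indicator (hφ hA)]
    refine lintegral_congr fun U => ?_
    by_cases hU : U ∈ φ ⁻¹' A
    · rw [Set.indicator_of_mem hU, Set.indicator_of_mem hU, mul_one]
    · rw [Set.indicator_of_notMem hU, Set.indicator_of_notMem hU, mul_zero]
  have hindS : ∀ U U' : GaugeField P j G, (∀ b ∉ S, U b = U' b) →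
      (φ ⁻¹' A).indicator (fun _ => (1 : ℝ≥0∞)) U = (φ ⁻¹' A).indicator (fun _ => (1 : ℝ≥0∞)) U' := by
    intro U U' hUU'
    have hφUU' : φ U = φ U' := hφS U U' hUU'
    by_cases hU : φ U ∈ A
    · have hU' : φ U' ∈ A := hφUU' ▸ hU
      rw [Set.indicator_of_mem (show U ∈ φ ⁻¹' A from hU), Set.indicator_of_mem (show U' ∈ φ ⁻¹' A from hU')]
    · have hU' : φ U' ∉ A := fun h' => hU (hφUU'.symm ▸ h')
      rw [Set.indicator_of_notMem (show U ∉ φ ⁻¹' A from hU), Set.indicator_of_notMem (show U' ∉ φ ⁻¹' A from hU')]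
  rw [h0, lintegral_mul_eq_mul_of_readSets S hf hind hfS hindS, lintegral_indicator_const (hφ hA), one_mul]

/-- ★ **EVENT FORM**: an event `E` determined by the bonds of `S` and a map `φ` reading only `Sᶜ` ⇒ `(dU↾E).map φ = dU(E) • dU.map φ`. [folklore] -/
theorem map_restrict_eq_smul_map_of_readSets {Y : Type*} [MeasurableSpace Y] {E : Set (GaugeField P j G)} (hE : MeasurableSet E)
    (hES : ∀ U U' : GaugeField P j G, (∀ b ∈ S, U b = U' b) → (U ∈ E ↔ U' ∈ E))
    {φ : GaugeField P j G → Y} (hφ : Measurable φ)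
    (hφS : ∀ U U' : GaugeField P j G, (∀ b ∉ S, U b = U' b) → φ U = φ U') :
    ((fieldMeasure P j G).restrict E).map φ = (fieldMeasure P j G E) • (fieldMeasure P j G).map φ := by
  classical
  have hind : ∀ U U' : GaugeField P j G, (∀ b ∈ S, U b = U' b) →
      E.indicator (1 : GaugeField P j G → ℝ≥0∞) U = E.indicator (1 : GaugeField P j G → ℝ≥0∞) U' := by
    intro U U' h
    by_cases hU : U ∈ E
    · have hU' : U' ∈ E := (hES U U' h).1 hU
      simp only [Set.indicator, hU, hU', if_true, Pi.one_apply]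
    · have hU' : U' ∉ E := fun h' => hU ((hES U U' h).2 h')
      simp only [Set.indicator, hU, hU', if_false]
  rw [← withDensity_indicator_one hE, map_withDensity_eq_smul_map_of_readSets S (measurable_one.indicator hE) hind hφ hφS,
    lintegral_indicator_one hE]

/-- ★ **BOCHNER FORM**: real `f` reading only `S` and `h` reading only `Sᶜ` (no integrability hypotheses — both sides take the same junk value otherwise) ⇒
`∫ f·h dU = (∫ f dU)·(∫ h dU)` (`integral_prod_mul` after the mix). [cite: Balaban1985Averaging, (10) p.19] -/
theorem integral_mul_eq_mul_of_readSets {f h : GaugeField P j G → ℝ} (hf : Measurable f) (hh : Measurable h)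
    (hfS : ∀ U U' : GaugeField P j G, (∀ b ∈ S, U b = U' b) → f U = f U')
    (hhS : ∀ U U' : GaugeField P j G, (∀ b ∉ S, U b = U' b) → h U = h U') :
    ∫ U, f U * h U ∂(fieldMeasure P j G) = (∫ U, f U ∂(fieldMeasure P j G)) * ∫ U, h U ∂(fieldMeasure P j G) := by
  classical
  have hΨ := measurable_mix (G := G) S
  have hmap := map_mix_prod_eq (G := G) S
  have hfhm : Measurable fun U : GaugeField P j G => f U * h U := hf.mul hh
  -- `∫ F ∂dU = ∫ F ∂(map Ψ (dU ⊗ dU)) = ∫ F∘Ψ ∂(dU ⊗ dU)`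
  have h0 := congrArg (fun m : Measure (GaugeField P j G) => ∫ U, f U * h U ∂m) hmap
  have h1 := integral_map (μ := (fieldMeasure P j G).prod (fieldMeasure P j G)) hΨ.aemeasurable hfhm.aestronglyMeasurable
  have h2 : ∀ p : GaugeField P j G × GaugeField P j G,
      f (fun b : PBond P j => if b ∈ S then p.1 b else p.2 b) * h (fun b : PBond P j => if b ∈ S then p.1 b else p.2 b) =
        f p.1 * h p.2 := by
    intro p
    have hfp : f (fun b : PBond P j => if b ∈ S then p.1 b else p.2 b) = f p.1 :=
      hfS _ p.1 (fun b hb => by simp [hb])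
    have hhp : h (fun b : PBond P j => if b ∈ S then p.1 b else p.2 b) = h p.2 :=
      hhS _ p.2 (fun b hb => by simp [hb])
    rw [hfp, hhp]
  refine (h0.symm.trans h1).trans ((integral_congr_ae (Filter.Eventually.of_forall fun p => h2 p)).trans ?_)
  exact integral_prod_mul f h

end Factorisation

end Summit.QuantumFields.YangMills.Theorems.UV3ReadSetFactorisation

end
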